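/-
Copyright (c) 2026 the pub-hodgecm-mathlib formalisation cell (harness21).  Prover seat hodgecm-mathlib-K2Liu-p11 (g0), Track B «K2-LIT»,
#184♮ = hLiu418 = `stmt-HodgeConjecture-24832`; K2E5-plan (g7) v3.22 row `K2LiuArchIntertwiningLieEquivariance` (→ p11 lineage): the
GROUP-LEVEL half, which is definitional.  THEOREMS ONLY.
-/
import Summits.HodgeConjecture.HodgeConjecture.Theorems.K2LiuArchInducedTubeDefs   -- ★ (this seat) (D∞): `archIntertwining`
import HarnessLib

/-!
# Crux `HLiu418`, A∞ organ: right-equivariance of the archimedean intertwining integral (group level)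

Cell `hodgecm-mathlib`, crux item hLiu418 = `stmt-HodgeConjecture-24832` (helper lane `--supports`, count-neutral).

`archIntertwining f g = ∫_{r} f (J · transl(hermOfReal r) · g) dr` commutes with RIGHT translations for free (associativity under the
integral, no convergence needed): `archIntertwining_rightTranslate : M_w (R_h f) g = (M_w f) (g h)`, plus linearity in `f`
(`archIntertwining_add/_smul/_sub` under integrability, `_const_mul` free).  The INFINITESIMAL (Lie-algebra) equivariance
`M_w(X·f) = X·(M_w f)` is the derivative of this identity along `h = exp(tY)` and needs differentiation under the `Herm` integral (sized M;
successor row `K2LiuArchIntertwiningLieEquivariance`).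
HONEST LABEL: HC_CM is proved only modulo the 7 printed citations (2 remaining named inputs: hLiu418 = stmt-HodgeConjecture-24832,
h413 = stmt-HodgeConjecture-24833) until rung 0 closes; count-neutral helper, closes no socket.
-/

set_option autoImplicit false
set_option linter.dupNamespace false

noncomputable section

open Complex MeasureTheory Matrix

namespace Summit.HodgeConjecture.HodgeConjecture.Cruxes.HLiu418.K2LiuArchIntertwiningRightEquivariance

open Summit.HodgeConjecture.HodgeConjecture.Cruxes.HLiu418.K2LiuArchInducedTubeDefs

variable {l : Type*} [Fintype l] [DecidableEq l]

/-- **RIGHT-EQUIVARIANCE (group level)**: `M_w(R_h f)(g) = (M_w f)(g h)` — definitional (associativity under the integral). -/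
theorem archIntertwining_rightTranslate (f : Matrix (l ⊕ l) (l ⊕ l) ℂ → ℂ) (g h : Matrix (l ⊕ l) (l ⊕ l) ℂ) :
    archIntertwining (fun x => f (x * h)) g = archIntertwining f (g * h) := by
  rw [archIntertwining_apply, archIntertwining_apply]
  refine integral_congr_ae (Filter.Eventually.of_forall fun r => ?_)
  simp only [Matrix.mul_assoc]

/-- The same read as functions of `g`: `M_w (R_h f) = R_h (M_w f)`. -/
theorem archIntertwining_rightTranslate_fun (f : Matrix (l ⊕ l) (l ⊕ l) ℂ → ℂ) (h : Matrix (l ⊕ l) (l ⊕ l) ℂ) :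
    archIntertwining (fun x => f (x * h)) = fun g => archIntertwining f (g * h) :=
  funext fun g => archIntertwining_rightTranslate f g h

/-- Scalars come out for free: `M_w (c·f) = c·M_w f`. -/
theorem archIntertwining_const_mul (c : ℂ) (f : Matrix (l ⊕ l) (l ⊕ l) ℂ → ℂ) (g : Matrix (l ⊕ l) (l ⊕ l) ℂ) :
    archIntertwining (fun x => c * f x) g = c * archIntertwining f g := by
  rw [archIntertwining_apply, archIntertwining_apply, ← integral_const_mul]

/-- Additivity under integrability of both big-cell integrands: `M_w (f₁ + f₂) = M_w f₁ + M_w f₂`. -/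
theorem archIntertwining_add {f₁ f₂ : Matrix (l ⊕ l) (l ⊕ l) ℂ → ℂ} {g : Matrix (l ⊕ l) (l ⊕ l) ℂ}
    (h₁ : Integrable fun r : l → l → ℝ => f₁ (Matrix.J l ℂ * fromBlocks 1 (hermOfReal r) 0 1 * g))
    (h₂ : Integrable fun r : l → l → ℝ => f₂ (Matrix.J l ℂ * fromBlocks 1 (hermOfReal r) 0 1 * g)) :
    archIntertwining (fun x => f₁ x + f₂ x) g = archIntertwining f₁ g + archIntertwining f₂ g := by
  rw [archIntertwining_apply, archIntertwining_apply, archIntertwining_apply, ← integral_add h₁ h₂]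

/-- Subtraction under integrability: `M_w (f₁ − f₂) = M_w f₁ − M_w f₂`. -/
theorem archIntertwining_sub {f₁ f₂ : Matrix (l ⊕ l) (l ⊕ l) ℂ → ℂ} {g : Matrix (l ⊕ l) (l ⊕ l) ℂ}
    (h₁ : Integrable fun r : l → l → ℝ => f₁ (Matrix.J l ℂ * fromBlocks 1 (hermOfReal r) 0 1 * g))
    (h₂ : Integrable fun r : l → l → ℝ => f₂ (Matrix.J l ℂ * fromBlocks 1 (hermOfReal r) 0 1 * g)) :
    archIntertwining (fun x => f₁ x - f₂ x) g = archIntertwining f₁ g - archIntertwining f₂ g := by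
  rw [archIntertwining_apply, archIntertwining_apply, archIntertwining_apply, ← integral_sub h₁ h₂]

/-- Finite linear combinations under integrability: `M_w (Σ c_i f_i) = Σ c_i M_w f_i`. -/
theorem archIntertwining_finsetSum {ι : Type*} (S : Finset ι) (c : ι → ℂ) (f : ι → Matrix (l ⊕ l) (l ⊕ l) ℂ → ℂ)
    {g : Matrix (l ⊕ l) (l ⊕ l) ℂ} (hf : ∀ i ∈ S, Integrable fun r : l → l → ℝ => f i (Matrix.J l ℂ * fromBlocks 1 (hermOfReal r) 0 1 * g)) :
    archIntertwining (fun x => ∑ i ∈ S, c i * f i x) g = ∑ i ∈ S, c i * archIntertwining (f i) g := by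
  rw [archIntertwining_apply]
  have h := integral_finsetSum S (f := fun i (r : l → l → ℝ) => c i * f i (Matrix.J l ℂ * fromBlocks 1 (hermOfReal r) 0 1 * g))
    (fun i hi => (hf i hi).const_mul (c i))
  rw [h]
  refine Finset.sum_congr rfl fun i _ => ?_
  rw [integral_const_mul, archIntertwining_apply]

end Summit.HodgeConjecture.HodgeConjecture.Cruxes.HLiu418.K2LiuArchIntertwiningRightEquivariance

end
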